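import Literature.Barriers.CriticalPhenomena.RigorousRGSmallParameterLocalPolynomial
import Literature.Barriers.CriticalPhenomena.RigorousRGSmallParameterTphiLaplacian
import HarnessLib

/-!
# `RigorousRGSmallParameter` (Slade, Theorem 1.4.1): `‖τ_x‖_{T_0} = ½n𝔥²`, `‖τ_x²‖_{T_0} = ¼n²𝔥⁴` and
# `‖V(B)‖_{T_0} ≍ |B|·max(|g|¼n²𝔥⁴, |ν|½n𝔥², |u|)` ([BS-rg-IE] Lemma 3.1.1 for Slade's `V`)

Companion ("proof architecture") file of
`Literature/Barriers/CriticalPhenomena/RigorousRGSmallParameter.lean`, first brick of the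
ESTIMATES behind Slade's Theorem 6.3.1 (whose iterate is the named fact `Slade2017_prop822`). The
stability analysis of [BS-rg-IE] is driven by the small parameter `ε_V`; Slade §6.4.3:
"`ε_V = ε_V(𝔥_j) = L^{dj}(‖gτ_x²‖_{T_0(𝔥_j)} + ‖ντ_x‖_{T_0(𝔥_j)})` … Computation gives
`ε_V ≍ |g|L^{dj}𝔥_j⁴ + |ν|L^{dj}𝔥_j²`", and [BS-rg-IE] Lemma 3.1.1: "For `V ∈ 𝒬` and `j < N`,
`ε_{V,j} ≍ max_{B ∈ ℬ_j} ‖V(B)‖_{T_{0,j}}`", proved by pairing with dual test functions: "given a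
monomial `M` we seek a unit `Φ`-norm test function `f_M` such that, for all `x ∈ B`,
`⟨M_x, f_M⟩ = ‖M_x‖_{T_0}` but `⟨M'_x, f_M⟩ = 0` if `M' ≠ M` … we choose `f_M` … constant on the set of
these sequences … `‖M_0‖_{T_0} = |⟨M_x,f_M⟩_0| = |B|⁻¹|⟨V(B),f_M⟩_0| ≤ |B|⁻¹‖V(B)‖_{T_0}`".
The tree had the upper bounds (`…LocalPolynomial.TphiNorm_tau_zero_le`, `TphiNorm_localPoly_zero_le`);
this file PROVES the matching lower bounds and the comparability, for the real `n`-component field: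

* `Tphi.lengthTF` (the constant test function on one sequence length), `pairing_lengthTF`,
  **`Tphi.sumSeq_star`** (`Σ_{|z|=r}(F⋆G)_z = Σ_{k+l=r} C(k+l,k)(Σ_{|u|=k}F_u)(Σ_{|v|=l}G_v)`);
* `napply_lengthTF` (`∇^α` kills it for `α ≠ ∅`), **`lengthTF_mem_ball`** (it lies in `B(Φ(𝔥))`),
  **`factorial_inv_mul_le_TphiNorm`** (`(1/r!)𝔥^r|Σ_{|z|=r}F_z(φ)| ≤ ‖F‖_{T_φ(𝔥)}`);
* `sumSeq_coeffFamily_tau` (`= n𝟙_{k=2}`), **`TphiNorm_tau_zero_eq`** (`‖τ_x‖_{T_0} = ½n𝔥²`),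
  `sumSeq_coeffFamily_tau_sq` (`= 6n²𝟙_{k=4}`), **`TphiNorm_tau_sq_zero_eq`** (`‖τ_x²‖_{T_0} = ¼n²𝔥⁴`,
  upper bound by the product property);
* `sumSeq_coeffFamily_localPoly/localPolySum`, `epsSite`, **`card_mul_epsSite_le_TphiNorm`**
  (`|B|·max(|g|¼n²𝔥⁴, |ν|½n𝔥², |u|) ≤ ‖V(B)‖_{T_0}`), `TphiNorm_localPolySum_zero_le`,
  **`TphiNorm_localPolySum_zero_le_three_mul`** (`‖V(B)‖_{T_0} ≤ 3|B|·max(⋯)`).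

Sources: D. C. Brydges, G. Slade, *A renormalisation group method. IV. Stability analysis*,
J. Stat. Phys. 159 (2015) 530–588, arXiv:1403.7255, §3.1.1 Lemma 3.1.1 (TeX-source numbering) and
its proof; G. Slade, arXiv:1611.06169, §6.4.3 (displays (6.46)–(6.47)); Brydges–Slade I,
arXiv:1403.7244, Proposition 3.5.1, §5.1.

## References

* [BrydgesSlade2015] D. C. Brydges, G. Slade, *A renormalisation group method. IV. Stability
  analysis*, J. Stat. Phys. **159** (2015) 530–588, arXiv:1403.7255.
* [BrydgesSlade2015RGI] D. C. Brydges, G. Slade, *A renormalisation group method. I*, J. Stat.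
  Phys. **159** (2015) 421–460, arXiv:1403.7244.
* [Slade2017] G. Slade, *Critical exponents for long-range O(n) models below the upper critical
  dimension*, Commun. Math. Phys. **358** (2018) 343–436, arXiv:1611.06169.
-/

noncomputable section

namespace Literature.Barriers.CriticalPhenomena

namespace LongRangePhi4

namespace Tphi

open Finset

/-! ### Constant test functions concentrated on one length -/

section LengthTF

variable {Ξ : Type*}

/-- The test function equal to `c` on sequences of length `r` and `0` elsewhere (constant in the
positions, so all finite-difference derivatives vanish). [cite: BrydgesSlade2015, §3.1.1 (proof of Lemma 3.1.1: "we choose f_M … constant on the set of these sequences")] -/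
def lengthTF (r : ℕ) (c : ℝ) : List Ξ → ℝ := fun z => if z.length = r then c else 0

/-- Value on a sequence of the right length. [folklore] -/
theorem lengthTF_of_eq {r : ℕ} (c : ℝ) {z : List Ξ} (hz : z.length = r) : lengthTF r c z = c := by
  simp [lengthTF, hz]

/-- Value on a sequence of the wrong length. [folklore] -/
theorem lengthTF_of_ne {r : ℕ} (c : ℝ) {z : List Ξ} (hz : z.length ≠ r) : lengthTF r c z = 0 := by
  simp [lengthTF, hz]

variable [Fintype Ξ]

/-- **Pairing with a length-concentrated constant**: `⟨F, lengthTF r c⟩ = (1/r!) c Σ_{|z|=r} F_z`. [folklore] -/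
theorem pairing_lengthTF {pN r : ℕ} (hr : r ≤ pN) (F : List Ξ → ℝ) (c : ℝ) :
    pairing pN F (lengthTF r c) = ((r.factorial : ℝ)⁻¹) * (c * sumSeq r F) := by
  unfold pairing
  rw [Finset.sum_eq_single r]
  · congr 1
    rw [← sumSeq_mul_left]
    refine sumSeq_congr r fun z hz => ?_
    rw [lengthTF_of_eq c hz, mul_comm]
  · intro r' _ hr'
    rw [sumSeq_congr r' (g := fun _ => (0 : ℝ)) (fun z hz => by rw [lengthTF_of_ne c (by omega), mul_zero]),
      sumSeq_zero_fun, mul_zero]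
  · intro h
    exact absurd (Finset.mem_range.2 (by omega)) h

/-- **`Σ_{|z|=r} (F ⋆ G)_z = Σ_{k+l=r} C(k+l,k) (Σ_{|u|=k} F_u)(Σ_{|v|=l} G_v)`** (regrouping
complementary pairs as interleavings, `sumSeq_splits`, for a summand independent of the
interleaving). [cite: BrydgesSlade2015RGI, §5.1 (proof of Lemma 5.1.1)] -/
theorem sumSeq_star [DecidableEq Ξ] (r : ℕ) (F G : List Ξ → ℝ) :
    sumSeq r (star F G) = ∑ kl ∈ antidiagonal r, (((kl.1 + kl.2).choose kl.1 : ℕ) : ℝ) * (sumSeq kl.1 F * sumSeq kl.2 G) := by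
  have h := sumSeq_splits (Ξ := Ξ) (M := ℝ) r (fun u v _ => F u * G v)
  calc sumSeq r (star F G)
      = sumSeq r (fun z => ((splits z).map fun p => (fun u v (_ : List Ξ) => F u * G v) p.1 p.2 z).sum) := rfl
    _ = ∑ kl ∈ antidiagonal r, shuffleSum (fun u v (_ : List Ξ) => F u * G v) kl.1 kl.2 := h
    _ = _ := by
      refine Finset.sum_congr rfl fun kl _ => ?_
      unfold shuffleSum
      simp only [List.map_const', List.sum_replicate, nsmul_eq_mul, length_masks]
      have e1 : (fun u => sumSeq kl.2 fun v => (((kl.1 + kl.2).choose kl.1 : ℕ) : ℝ) * (F u * G v)) =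
          fun u => ((((kl.1 + kl.2).choose kl.1 : ℕ) : ℝ) * sumSeq kl.2 G) * F u := by
        funext u
        rw [show (fun v => (((kl.1 + kl.2).choose kl.1 : ℕ) : ℝ) * (F u * G v)) =
            fun v => ((((kl.1 + kl.2).choose kl.1 : ℕ) : ℝ) * F u) * G v from funext fun v => by ring,
          sumSeq_mul_left]
        ring
      rw [e1, sumSeq_mul_left]
      ring

end LengthTF

end Tphi

namespace LocalPoly

open Finset Tphi RGNorm Literature.Probability.LatticeModels
open scoped ContDiff

variable {d M n : ℕ} [NeZero M]

/-! ### The length-concentrated constants are in the unit ball of `Φ(𝔥)` -/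

section Ball

variable {Λ ι S : Type*} [AddCommGroup Λ] (step : S → Λ)

/-- `∇^α` kills functions that depend only on the length, for `α ≠ ∅` (and leaves them for `α = ∅`). [folklore] -/
theorem napply_lengthTF (r : ℕ) (c : ℝ) :
    ∀ α : List (ℕ × S), napply step α (lengthTF r c : List (Λ × ι) → ℝ) = lengthTF r (if α = [] then c else 0)
  | [] => by simp
  | q :: α => by
      rw [napply_cons, napply_lengthTF r c α]
      funext z
      simp only [diffOp, lengthTF, length_shiftAt, sub_self]
      simp

/-- **`lengthTF r (𝔥^r) ∈ B(Φ(𝔥))`** for `r ≤ p_𝒩`: it vanishes on long sequences, `|g_z| = 𝔥^{|z|}` on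
its support and `∇^α g = 0` for `α ≠ ∅`. [folklore] -/
theorem lengthTF_mem_ball {𝔥 : ℝ} (h𝔥 : 0 < 𝔥) (R : ℝ) (pΦ : ℕ) {pN r : ℕ} (hr : r ≤ pN) :
    (lengthTF r (𝔥 ^ r) : List (Λ × ι) → ℝ) ∈ ball pN (latticeFamily step 𝔥 R pΦ) := by
  refine ⟨fun z hz => lengthTF_of_ne _ (by omega), ?_⟩
  rintro ℓ ⟨α, z, -, rfl⟩
  rw [latticeFun_apply, napply_lengthTF]
  by_cases hα : α = []
  · subst hα
    simp only [if_true, List.length_nil, pow_zero, mul_one]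
    by_cases hz : z.length = r
    · rw [lengthTF_of_eq _ hz, ← hz, inv_mul_cancel₀ (pow_ne_zero _ h𝔥.ne')]
      simp
    · rw [lengthTF_of_ne _ hz, mul_zero, abs_zero]
      exact zero_le_one
  · simp only [hα, if_false]
    rw [show (lengthTF r (0 : ℝ) : List (Λ × ι) → ℝ) z = 0 by simp [lengthTF], mul_zero, abs_zero]
    exact zero_le_one

end Ball

/-! ### Lower bounds for `T_φ` seminorms from one coefficient length -/

/-- **`(1/r!) 𝔥^r |Σ_{|z|=r} F_z(φ)| ≤ ‖F‖_{T_φ(𝔥)}`** (pair with `lengthTF r (𝔥^r) ∈ B(Φ)`).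
[cite: BrydgesSlade2015, §3.1.1 (proof of Lemma 3.1.1, display (T0epid))] -/
theorem factorial_inv_mul_le_TphiNorm {𝔥 R : ℝ} (h𝔥 : 0 < 𝔥) (hR : 0 < R) (pΦ : ℕ) {pN r : ℕ} (hr : r ≤ pN)
    (F : (TorusSite d M → Fin n → ℝ) → ℝ) (φ : TorusSite d M → Fin n → ℝ) :
    ((r.factorial : ℝ)⁻¹) * 𝔥 ^ r * |sumSeq r (coeffFamily (basisDir d M n) F φ)| ≤
      TphiNorm pN (latticeFamily (unitStep d M) 𝔥 R pΦ) (basisDir d M n) F φ := by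
  have hg := lengthTF_mem_ball (unitStep d M) (Λ := TorusSite d M) (ι := Fin n) h𝔥 R pΦ hr
  have h := abs_pairing_le_Tnorm (latticeFamily_evalBound (unitStep d M) h𝔥 hR pΦ pN (ι := Fin n))
    (coeffFamily (basisDir d M n) F φ) hg
  rw [pairing_lengthTF hr, abs_mul, abs_mul, abs_inv, Nat.abs_cast, abs_of_pos (pow_pos h𝔥 r), ← mul_assoc] at h
  exact h

/-! ### `‖τ_x‖_{T_0} = ½ n 𝔥²` -/

/-- `Σ_{|z|=2} (τ_x)_z(0) = n`. [folklore] -/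
theorem sumSeq_two_coeffFamily_tau (x : TorusSite d M) :
    sumSeq 2 (coeffFamily (basisDir d M n) (tau x) 0) = n := by
  have h := sumSeq_two_diag (n := n) x 1
  rw [mul_one] at h
  rw [← h]
  refine sumSeq_congr 2 fun z hz => ?_
  match z, hz with
  | [q', q], _ =>
      simp only [coeffFamily, coeff_tau_two, mul_one]

/-- **`‖τ_x‖_{T_0(𝔥)} = ½ n 𝔥²`** (upper bound `TphiNorm_tau_zero_le`; lower bound by pairing with
the constant test function on diagonal length-two sequences). [cite: BrydgesSlade2015RGI, Proposition 3.5.1] [cite: Slade2017, §6.4.3 (ε_V ≍ |g|L^{dj}𝔥⁴ + |ν|L^{dj}𝔥²)] -/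
theorem TphiNorm_tau_zero_eq {𝔥 R : ℝ} (h𝔥 : 0 < 𝔥) (hR : 0 < R) (pΦ : ℕ) {pN : ℕ} (hpN : 2 ≤ pN) (x : TorusSite d M) :
    TphiNorm pN (latticeFamily (unitStep d M) 𝔥 R pΦ) (basisDir d M n) (tau x) 0 = 2⁻¹ * n * 𝔥 ^ 2 := by
  apply le_antisymm (TphiNorm_tau_zero_le h𝔥 hR pΦ pN x)
  have h := factorial_inv_mul_le_TphiNorm h𝔥 hR pΦ hpN (tau (n := n) x) 0
  rw [sumSeq_two_coeffFamily_tau, Nat.abs_cast] at h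
  have e : ((Nat.factorial 2 : ℕ) : ℝ)⁻¹ * 𝔥 ^ 2 * (n : ℝ) = 2⁻¹ * n * 𝔥 ^ 2 := by
    simp [Nat.factorial]; ring
  rwa [e] at h

/-! ### `‖τ_x²‖_{T_0} = ¼ n² 𝔥⁴` -/

/-- `Σ_{|z|=0} (τ_x)_z(0) = τ_x(0) = 0`. [folklore] -/
theorem sumSeq_zero_coeffFamily_tau (x : TorusSite d M) : sumSeq 0 (coeffFamily (basisDir d M n) (tau x) 0) = 0 := by
  simp [coeffFamily, coeff_nil, tau]

/-- `Σ_{|z|=1} (τ_x)_z(0) = 0`. [folklore] -/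
theorem sumSeq_one_coeffFamily_tau (x : TorusSite d M) : sumSeq 1 (coeffFamily (basisDir d M n) (tau x) 0) = 0 := by
  simp only [sumSeq_succ, sumSeq_zero, coeffFamily, coeff_tau_one]
  refine Finset.sum_eq_zero fun q _ => ?_
  split_ifs <;> simp [ev]

/-- `Σ_{|z|=r} (τ_x)_z(0) = 0` for `r ≥ 3`. [folklore] -/
theorem sumSeq_coeffFamily_tau_eq_zero (x : TorusSite d M) {r : ℕ} (hr : 2 < r) :
    sumSeq r (coeffFamily (basisDir d M n) (tau x) 0) = 0 := by
  rw [sumSeq_congr r (g := fun _ => (0 : ℝ)) fun z hz => ?_, sumSeq_zero_fun]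
  simp only [coeffFamily, coeff_tau_eq_zero x z (by omega)]

/-- `Σ_{|z|=k} (τ_x)_z(0) = n 𝟙_{k=2}`. [folklore] -/
theorem sumSeq_coeffFamily_tau (x : TorusSite d M) (k : ℕ) :
    sumSeq k (coeffFamily (basisDir d M n) (tau x) 0) = if k = 2 then (n : ℝ) else 0 := by
  match k with
  | 0 => rw [if_neg (by omega)]; exact sumSeq_zero_coeffFamily_tau x
  | 1 => rw [if_neg (by omega)]; exact sumSeq_one_coeffFamily_tau x
  | 2 => rw [if_pos rfl]; exact sumSeq_two_coeffFamily_tau x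
  | k + 3 => rw [if_neg (by omega)]; exact sumSeq_coeffFamily_tau_eq_zero x (by omega)

/-- **`Σ_{|z|=k} (τ_x²)_z(0) = 6n² 𝟙_{k=4}`** (Leibniz/`⋆` and the regrouping: only the splitting
`(2,2)` contributes, with `C(4,2) = 6` interleavings). [folklore] -/
theorem sumSeq_coeffFamily_tau_sq (x : TorusSite d M) (k : ℕ) :
    sumSeq k (coeffFamily (basisDir d M n) (fun φ => tau x φ * tau x φ) 0) = if k = 4 then 6 * (n : ℝ) ^ 2 else 0 := by
  classical
  rw [coeffFamily_mul (basisDir d M n) (contDiff_tau x) (contDiff_tau x), sumSeq_star]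
  simp only [sumSeq_coeffFamily_tau]
  have hkill : ∀ kl : ℕ × ℕ, ¬ (kl.1 = 2 ∧ kl.2 = 2) →
      (((kl.1 + kl.2).choose kl.1 : ℕ) : ℝ) * ((if kl.1 = 2 then (n : ℝ) else 0) * (if kl.2 = 2 then (n : ℝ) else 0)) = 0 := by
    intro kl hkl
    rcases not_and_or.1 hkl with h | h
    · rw [if_neg h]; ring
    · rw [if_neg h]; ring
  by_cases hk : k = 4
  · subst hk
    rw [if_pos rfl, Finset.sum_eq_single (2, 2)]
    · simp only [if_true]
      norm_num [Nat.choose_two_right]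
      ring
    · intro kl _ hne
      refine hkill kl fun h => hne ?_
      exact Prod.ext h.1 h.2
    · intro h
      exact absurd (by simp) h
  · rw [if_neg hk]
    refine Finset.sum_eq_zero fun kl hkl => hkill kl fun h => hk ?_
    rw [Finset.mem_antidiagonal] at hkl
    omega

/-- **`‖τ_x²‖_{T_0(𝔥)} = ¼ n² 𝔥⁴`** (upper bound by the product property; lower bound by pairing with
the constant test function on length-four sequences). [cite: Slade2017, §6.4.3 (ε_V ≍ |g|L^{dj}𝔥⁴ + |ν|L^{dj}𝔥²)] [cite: BrydgesSlade2015, Lemma 3.1.1] -/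
theorem TphiNorm_tau_sq_zero_eq {𝔥 R : ℝ} (h𝔥 : 0 < 𝔥) (hR : 0 < R) (pΦ : ℕ) {pN : ℕ} (hpN : 4 ≤ pN) (x : TorusSite d M) :
    TphiNorm pN (latticeFamily (unitStep d M) 𝔥 R pΦ) (basisDir d M n) (fun φ => tau x φ * tau x φ) 0 =
      4⁻¹ * (n : ℝ) ^ 2 * 𝔥 ^ 4 := by
  apply le_antisymm
  · have h := TphiNorm_mul_le (latticeFamily_shuffleCompat (unitStep d M) h𝔥 hR pΦ pN)
      (latticeFamily_evalBound (unitStep d M) h𝔥 hR pΦ pN) (basisDir d M n) (contDiff_tau x) (contDiff_tau x)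
      (0 : TorusSite d M → Fin n → ℝ)
    rw [TphiNorm_tau_zero_eq h𝔥 hR pΦ (by omega) x] at h
    refine h.trans (le_of_eq ?_)
    ring
  · have h := factorial_inv_mul_le_TphiNorm h𝔥 hR pΦ hpN (fun φ => tau (n := n) x φ * tau x φ) 0
    rw [sumSeq_coeffFamily_tau_sq, if_pos rfl] at h
    have e : ((Nat.factorial 4 : ℕ) : ℝ)⁻¹ * 𝔥 ^ 4 * |6 * (n : ℝ) ^ 2| = 4⁻¹ * (n : ℝ) ^ 2 * 𝔥 ^ 4 := by
      rw [abs_of_nonneg (by positivity)]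
      simp [Nat.factorial]
      ring
    rwa [e] at h

/-! ### Coefficient sums of `V_x` and `V(B)`; two-sided bounds for `‖V(B)‖_{T_0}` -/

/-- `Σ_{|z|=k} (V_x)_z(0) = g·6n²𝟙_{k=4} + ν·n𝟙_{k=2} + u𝟙_{k=0}`. [folklore] -/
theorem sumSeq_coeffFamily_localPoly (g ν u : ℝ) (x : TorusSite d M) (k : ℕ) :
    sumSeq k (coeffFamily (basisDir d M n) (localPoly g ν u x) 0) =
      g * (if k = 4 then 6 * (n : ℝ) ^ 2 else 0) + ν * (if k = 2 then (n : ℝ) else 0) + (if k = 0 then u else 0) := by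
  have hτ := contDiff_tau (d := d) (M := M) (n := n) x
  have hτ2 : ContDiff ℝ ∞ (fun φ => tau (d := d) (M := M) (n := n) x φ * tau x φ) := hτ.mul hτ
  have hsq : (fun φ => tau (d := d) (M := M) (n := n) x φ ^ 2) = fun φ => tau x φ * tau x φ := by
    funext φ; ring
  have e : localPoly (n := n) g ν u x =
      fun φ => ((fun ψ => g * (tau x ψ * tau x ψ)) φ + (fun ψ => ν * tau x ψ) φ) + (fun _ => u) φ := by
    funext φ; simp only [localPoly]; ring
  rw [e, coeffFamily_add _ ((contDiff_const.mul hτ2).add (contDiff_const.mul hτ)) contDiff_const,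
    sumSeq_add, coeffFamily_add _ (contDiff_const.mul hτ2) (contDiff_const.mul hτ), sumSeq_add]
  have h1 : sumSeq k (coeffFamily (basisDir d M n) (fun ψ => g * (tau x ψ * tau x ψ)) 0) =
      g * (if k = 4 then 6 * (n : ℝ) ^ 2 else 0) := by
    rw [← sumSeq_coeffFamily_tau_sq x k, ← sumSeq_mul_left]
    refine sumSeq_congr k fun z _ => ?_
    simp only [coeffFamily, coeff_const_mul _ hτ2 g z]
  have h2 : sumSeq k (coeffFamily (basisDir d M n) (fun ψ => ν * tau x ψ) 0) = ν * (if k = 2 then (n : ℝ) else 0) := by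
    rw [← sumSeq_coeffFamily_tau x k, ← sumSeq_mul_left]
    refine sumSeq_congr k fun z _ => ?_
    simp only [coeffFamily, coeff_const_mul _ hτ ν z]
  have h3 : sumSeq k (coeffFamily (basisDir d M n) (fun _ : TorusSite d M → Fin n → ℝ => u) 0) = if k = 0 then u else 0 := by
    by_cases hk : k = 0
    · subst hk; simp [coeffFamily, coeff_nil]
    · rw [if_neg hk, sumSeq_congr k (g := fun _ => (0 : ℝ)) fun z hz => ?_, sumSeq_zero_fun]
      have hz' : z ≠ [] := by rintro rfl; exact hk (by simpa using hz.symm)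
      simp only [coeffFamily, coeff_const_eq_zero _ u z hz']
  rw [h1, h2, h3]

/-- `Σ_{|z|=k} (V(B))_z(0) = |B|·(g·6n²𝟙_{k=4} + ν·n𝟙_{k=2} + u𝟙_{k=0})`. [folklore] -/
theorem sumSeq_coeffFamily_localPolySum (g ν u : ℝ) (B : Finset (TorusSite d M)) (k : ℕ) :
    sumSeq k (coeffFamily (basisDir d M n) (localPolySum g ν u B) 0) =
      B.card * (g * (if k = 4 then 6 * (n : ℝ) ^ 2 else 0) + ν * (if k = 2 then (n : ℝ) else 0) + (if k = 0 then u else 0)) := by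
  have e : coeffFamily (basisDir d M n) (localPolySum (n := n) g ν u B) 0 =
      fun z => ∑ x ∈ B, coeffFamily (basisDir d M n) (localPoly g ν u x) 0 z := by
    funext z
    simp only [coeffFamily]
    rw [show localPolySum (n := n) g ν u B = fun φ => ∑ x ∈ B, localPoly g ν u x φ from rfl,
      coeff_finset_sum _ B (fun x _ => contDiff_localPoly g ν u x) z]
  rw [e, sumSeq_sum B k (fun z x => coeffFamily (basisDir d M n) (localPoly g ν u x) 0 z)]
  simp only [sumSeq_coeffFamily_localPoly, Finset.sum_const, nsmul_eq_mul]

/-- The block-level small parameter `max(|g|·¼n²𝔥⁴, |ν|·½n𝔥², |u|)` (per site). [cite: Slade2017, §6.4.3 (display (6.47): ε_V ≍ |g|L^{dj}𝔥_j⁴ + |ν|L^{dj}𝔥_j²)] -/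
def epsSite (n : ℕ) (𝔥 g ν u : ℝ) : ℝ := max (|g| * (4⁻¹ * (n : ℝ) ^ 2 * 𝔥 ^ 4)) (max (|ν| * (2⁻¹ * n * 𝔥 ^ 2)) |u|)

/-- **Lower bound (BS-rg-IE Lemma 3.1.1 for Slade's `V`, `ε ≺ ‖V(B)‖_{T_0}`)**:
`|B|·max(|g|¼n²𝔥⁴, |ν|½n𝔥², |u|) ≤ ‖V(B)‖_{T_0(𝔥)}` — dual test functions concentrated on one
length single out each monomial. [cite: BrydgesSlade2015, Lemma 3.1.1 (proof: (M0V)–(T0epid))] [cite: Slade2017, §6.4.3] -/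
theorem card_mul_epsSite_le_TphiNorm {𝔥 R : ℝ} (h𝔥 : 0 < 𝔥) (hR : 0 < R) (pΦ : ℕ) {pN : ℕ} (hpN : 4 ≤ pN)
    (g ν u : ℝ) (B : Finset (TorusSite d M)) :
    B.card * epsSite n 𝔥 g ν u ≤ TphiNorm pN (latticeFamily (unitStep d M) 𝔥 R pΦ) (basisDir d M n) (localPolySum g ν u B) 0 := by
  have hB : (0 : ℝ) ≤ B.card := by positivity
  have h4 := factorial_inv_mul_le_TphiNorm h𝔥 hR pΦ hpN (localPolySum (n := n) g ν u B) 0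
  have h2 := factorial_inv_mul_le_TphiNorm h𝔥 hR pΦ (show 2 ≤ pN by omega) (localPolySum (n := n) g ν u B) 0
  have h0 := factorial_inv_mul_le_TphiNorm h𝔥 hR pΦ (Nat.zero_le pN) (localPolySum (n := n) g ν u B) 0
  rw [sumSeq_coeffFamily_localPolySum] at h4 h2 h0
  simp only [if_true, show (4 : ℕ) ≠ 2 by decide, show (4 : ℕ) ≠ 0 by decide, show (2 : ℕ) ≠ 4 by decide,
    show (2 : ℕ) ≠ 0 by decide, show (0 : ℕ) ≠ 4 by decide, show (0 : ℕ) ≠ 2 by decide, if_false,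
    mul_zero, add_zero, zero_add] at h4 h2 h0
  have e4 : ((Nat.factorial 4 : ℕ) : ℝ)⁻¹ * 𝔥 ^ 4 * |(B.card : ℝ) * (g * (6 * (n : ℝ) ^ 2))| =
      B.card * (|g| * (4⁻¹ * (n : ℝ) ^ 2 * 𝔥 ^ 4)) := by
    rw [abs_mul, abs_mul, abs_of_nonneg hB, abs_of_nonneg (by positivity : (0:ℝ) ≤ 6 * (n : ℝ) ^ 2)]
    simp [Nat.factorial]; ring
  have e2 : ((Nat.factorial 2 : ℕ) : ℝ)⁻¹ * 𝔥 ^ 2 * |(B.card : ℝ) * (ν * (n : ℝ))| = B.card * (|ν| * (2⁻¹ * n * 𝔥 ^ 2)) := by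
    rw [abs_mul, abs_mul, abs_of_nonneg hB, Nat.abs_cast]
    simp [Nat.factorial]; ring
  have e0 : ((Nat.factorial 0 : ℕ) : ℝ)⁻¹ * 𝔥 ^ 0 * |(B.card : ℝ) * u| = B.card * |u| := by
    rw [abs_mul, abs_of_nonneg hB]; simp
  rw [e4] at h4
  rw [e2] at h2
  rw [e0] at h0
  unfold epsSite
  rcases le_total (|g| * (4⁻¹ * (n : ℝ) ^ 2 * 𝔥 ^ 4)) (max (|ν| * (2⁻¹ * n * 𝔥 ^ 2)) |u|) with hm | hm
  · rw [max_eq_right hm]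
    rcases le_total (|ν| * (2⁻¹ * n * 𝔥 ^ 2)) |u| with hm' | hm'
    · rw [max_eq_right hm']; exact h0
    · rw [max_eq_left hm']; exact h2
  · rw [max_eq_left hm]; exact h4

/-- **Upper bound**: `‖V(B)‖_{T_0(𝔥)} ≤ |B|(|g|¼n²𝔥⁴ + |ν|½n𝔥² + |u|) ≤ 3|B|·max(⋯)` (subadditivity
over sites and `TphiNorm_localPoly_zero_le`). [cite: BrydgesSlade2015, Lemma 3.1.1 ("‖V(B)‖_{T_0} ≺ ε_V" by the triangle inequality)] [cite: Slade2017, §6.4.3] -/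
theorem TphiNorm_localPolySum_zero_le {𝔥 R : ℝ} (h𝔥 : 0 < 𝔥) (hR : 0 < R) (pΦ pN : ℕ) (g ν u : ℝ)
    (B : Finset (TorusSite d M)) :
    TphiNorm pN (latticeFamily (unitStep d M) 𝔥 R pΦ) (basisDir d M n) (localPolySum g ν u B) 0 ≤
      B.card * (|g| * (2⁻¹ * n * 𝔥 ^ 2) ^ 2 + |ν| * (2⁻¹ * n * 𝔥 ^ 2) + |u|) := by
  have e : coeffFamily (basisDir d M n) (localPolySum (n := n) g ν u B) 0 =
      fun z => ∑ x ∈ B, coeffFamily (basisDir d M n) (localPoly g ν u x) 0 z := by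
    funext z
    simp only [coeffFamily]
    rw [show localPolySum (n := n) g ν u B = fun φ => ∑ x ∈ B, localPoly g ν u x φ from rfl,
      coeff_finset_sum _ B (fun x _ => contDiff_localPoly g ν u x) z]
  unfold TphiNorm
  rw [e]
  refine (Tnorm_sum_le (latticeFamily_evalBound (unitStep d M) h𝔥 hR pΦ pN (ι := Fin n)) B _).trans ?_
  rw [show (B.card : ℝ) * (|g| * (2⁻¹ * n * 𝔥 ^ 2) ^ 2 + |ν| * (2⁻¹ * n * 𝔥 ^ 2) + |u|) =
      ∑ _x ∈ B, (|g| * (2⁻¹ * n * 𝔥 ^ 2) ^ 2 + |ν| * (2⁻¹ * n * 𝔥 ^ 2) + |u|) by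
    rw [Finset.sum_const, nsmul_eq_mul]]
  exact Finset.sum_le_sum fun x _ => TphiNorm_localPoly_zero_le h𝔥 hR pΦ pN g ν u x

/-- **Two-sided comparability `‖V(B)‖_{T_0(𝔥)} ≍ |B|·max(|g|¼n²𝔥⁴, |ν|½n𝔥², |u|)`** (BS-rg-IE
Lemma 3.1.1 "`ε_{V,j} ≍ max_B ‖V(B)‖_{T_{0,j}}`" for Slade's local polynomial; the upper
constant `3`). [cite: BrydgesSlade2015, Lemma 3.1.1] [cite: Slade2017, §6.4.3 (displays (6.46)–(6.47))] -/
theorem TphiNorm_localPolySum_zero_le_three_mul {𝔥 R : ℝ} (h𝔥 : 0 < 𝔥) (hR : 0 < R) (pΦ pN : ℕ) (g ν u : ℝ)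
    (B : Finset (TorusSite d M)) :
    TphiNorm pN (latticeFamily (unitStep d M) 𝔥 R pΦ) (basisDir d M n) (localPolySum g ν u B) 0 ≤
      3 * (B.card * epsSite n 𝔥 g ν u) := by
  refine (TphiNorm_localPolySum_zero_le h𝔥 hR pΦ pN g ν u B).trans ?_
  have hB : (0 : ℝ) ≤ B.card := by positivity
  have e : |g| * (2⁻¹ * n * 𝔥 ^ 2) ^ 2 = |g| * (4⁻¹ * (n : ℝ) ^ 2 * 𝔥 ^ 4) := by ring
  rw [e]
  have h1 : |g| * (4⁻¹ * (n : ℝ) ^ 2 * 𝔥 ^ 4) ≤ epsSite n 𝔥 g ν u := le_max_left _ _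
  have h2 : |ν| * (2⁻¹ * n * 𝔥 ^ 2) ≤ epsSite n 𝔥 g ν u := (le_max_left _ _).trans (le_max_right _ _)
  have h3 : |u| ≤ epsSite n 𝔥 g ν u := (le_max_right _ _).trans (le_max_right _ _)
  nlinarith

end LocalPoly

end LongRangePhi4

end Literature.Barriers.CriticalPhenomena
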